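import Literature.Probability.Percolation.ArmSeparationLandingGlue
import Literature.Probability.Percolation.ArmSeparationThinRing
import HarnessLib

/-!
# The far part of a corridor system: along the arc to the approach and up the target tube

Topic `Literature/Probability/Percolation`; family `crit-perc` / near-critical percolation on `𝕋`.
A brick of the near-critical arm-separation theorem for four arms in the ADJACENT colour
arrangement (P. Nolin, EJP 13 (2008), Thm. 11, `j = 4`, `σ = BBWW` [arXiv 0711.4948: Thm. 10]),
landing step. Set-level variant of the tree's `out_landing_glue`: from the start `X Te` of the
crossing of the entry piece `Te` of a chain `E :: L` of crossed tubes containing the run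
`V_{j₀}, …, V_{j₀+d}` of the side `x₀ = r` across the rows of the **approach tube**
`adjApproach r e t W h = [r - 2e, r - 2e + W] × [t - 2h, t - h - 1]` (crossed horizontally), one
reaches the approach, then — the approach crossing the **target tube**
`adjTarget N' t h = [N' + 1, N' + N'/16 - 1] × [t - 2h, t + h]` like a plus sign (`Tube.relay`) — the
start of a vertical crossing of the target tube and finally its end on the TOP row `t + h`:
`adj_far_path`. With `h = N'/64` the target tube contains the outer free space
`sepOuterFence N' (N', t)` across its full height above the approach rows, as needed by
`extOpenArm_of_pathIn`. Everything here is proved.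

## References

* P. Nolin, Near-critical percolation in two dimensions, *Electron. J. Probab.* 13 (2008), §4.3
  Prop. 12 (proof) (arXiv 0711.4948: Prop. 11) [Nolin2008].
* H. Kesten, *Percolation theory for mathematicians* (1982), §2.2 [KestenPTM1982].
-/

noncomputable section

open Set

namespace Literature.Probability.Percolation

open LatticeModels Tube

/-- **The approach tube**: horizontal, `[r - 2e, r - 2e + W] × [t - 2h, t - h - 1]`. [cite: Nolin2008, §4.3 Prop. 12 (proof) (arXiv 0711.4948: Prop. 11)] -/
def adjApproach (r e : ℕ) (t : ℤ) (W h : ℕ) : Tube := ⟨(r : ℤ) - 2 * e, t - 2 * h, W, h - 1, true⟩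

/-- **The target tube**: vertical, `[N' + 1, N' + N'/16 - 1] × [t - 2h, t + h]`. [cite: Nolin2008, §4.2 Def. 6 (arXiv 0711.4948)] -/
def adjTarget (N' : ℕ) (t : ℤ) (h : ℕ) : Tube := ⟨(N' : ℤ) + 1, t - 2 * h, N' / 16 - 2, 3 * h, false⟩

/-- The approach tube crosses the target tube (plus sign), when it ends at the column `N' + N'/16`
and `1 ≤ h`. [folklore] -/
theorem crosses_adjApproach_adjTarget {r e N' W h : ℕ} {t : ℤ} (hW : (r : ℤ) - 2 * e + W = N' + (N' / 16 : ℕ))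
    (hre : 2 * (e : ℤ) ≤ r) (hrN : (r : ℤ) - 2 * e ≤ N' + 1) (hh : 1 ≤ h) (hN : 32 ≤ N') :
    Crosses (adjApproach r e t W h) (adjTarget N' t h) := by
  left
  have h16 : ((N' / 16 - 2 : ℕ) : ℤ) = (N' / 16 : ℕ) - 2 := by omega
  have hh1 : ((h - 1 : ℕ) : ℤ) = (h : ℤ) - 1 := by omega
  refine ⟨rfl, rfl, ?_, ?_, ?_, ?_⟩ <;> simp only [adjApproach, adjTarget, h16, hh1] <;> push_cast <;> omega

/-- **The far path.** See the module docstring. [cite: Nolin2008, §4.3 Prop. 12 (proof) (arXiv 0711.4948: Prop. 11)] [cite: KestenPTM1982, §2.2] -/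
theorem adj_far_path {χ : SiteConfig (Site 2)} {E : Tube} {L : List Tube} (hch : List.IsChain Crosses (E :: L))
    {X Y : Tube → Site 2} (hXY : ∀ T ∈ E :: L, T.IsCrossing χ (X T) (Y T)) {Te : Tube} (hTe : Te ∈ E :: L)
    {r e s j₀ d : ℕ} {t : ℤ} {W h N' : ℕ} (hSL : ∀ T ∈ vchunks r (-(r : ℤ)) e s j₀ (d + 1), T ∈ E :: L)
    (hlo : -(r : ℤ) + j₀ * s - e ≤ t - 2 * h) (hhi : t - h - 1 ≤ -(r : ℤ) + (j₀ + d) * s - e) (hh : 2 ≤ h) (hWe : 3 * e ≤ W)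
    (hH : χ ∈ (adjApproach r e t W h).event) (hcr : Crosses (adjApproach r e t W h) (adjTarget N' t h))
    (hV : χ ∈ (adjTarget N' t h).event) :
    ∃ y : Site 2, y 1 = t + h ∧ y ∈ (adjTarget N' t h).box ∧
      PathIn triGraph ((boxAll (E :: L) ∪ (adjApproach r e t W h).box ∪ (adjTarget N' t h).box) ∩ χ) (X Te) y := by
  have hh1 : ((h - 1 : ℕ) : ℤ) = (h : ℤ) - 1 := by omega
  -- (1) the approach and the target crossings
  obtain ⟨xH, yH, hHc⟩ := (adjApproach r e t W h).exists_isCrossing hH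
  obtain ⟨xV, yV, hVc⟩ := (adjTarget N' t h).exists_isCrossing hV
  have PHV := relay hcr hHc hVc
  obtain ⟨hsV, PV⟩ := hVc
  simp only [adjTarget, cond_false] at hsV
  obtain ⟨hsH, PH⟩ := hHc
  simp only [adjApproach, cond_true] at hsH
  obtain ⟨SH, hSH, PH', TH⟩ := PH.exists_support
  have hSHb : ∀ z ∈ SH, t - 2 * h ≤ z 1 ∧ z 1 ≤ t - h - 1 := fun z hz => by
    have := (hSH hz).1; rw [Tube.mem_box] at this; simp only [adjApproach, hh1] at this; omega
  -- (2) the exit run, read with the prescribed crossings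
  obtain ⟨L₀, hL₀⟩ := vchunks_eq_cons (r : ℤ) (-(r : ℤ)) e s j₀ d
  have hchSL : List.IsChain Crosses (vPiece r (-(r : ℤ)) e s j₀ :: L₀) := hL₀ ▸ isChain_vchunks _ _ e s j₀ (d + 1)
  have hmemSL : ∀ T ∈ vPiece r (-(r : ℤ)) e s j₀ :: L₀, T ∈ vchunks r (-(r : ℤ)) e s j₀ (d + 1) := fun T hT => hL₀ ▸ hT
  have runs := chain_paths' X Y (vPiece r (-(r : ℤ)) e s j₀) L₀ hchSL (fun T hT => hXY T (hSL T (hmemSL T hT)))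
  have hlast : vPiece r (-(r : ℤ)) e s (j₀ + d) ∈ vPiece r (-(r : ℤ)) e s j₀ :: L₀ := by
    rw [← hL₀]; exact List.mem_of_mem_getLast? (by rw [getLast?_vchunks]; rfl)
  have PVr := runs _ hlast
  obtain ⟨SV, hSV, PV', TV⟩ := PVr.exists_support
  have hX0 : X (vPiece r (-(r : ℤ)) e s j₀) 1 = -(r : ℤ) + j₀ * s - e := by
    have := (hXY _ (hSL _ (hmemSL _ List.mem_cons_self))).1
    exact this.1.trans (by simp only [vPiece])
  have hX1 : X (vPiece r (-(r : ℤ)) e s (j₀ + d)) 1 = -(r : ℤ) + (j₀ + d) * s - e := by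
    have := (hXY _ (hSL _ (hmemSL _ hlast))).1
    exact this.1.trans (by simp only [vPiece, Nat.cast_add])
  have hSVb : ∀ z ∈ SV, (r : ℤ) - e ≤ z 0 ∧ z 0 ≤ (r : ℤ) + e := fun z hz => by
    obtain ⟨⟨T, hT, hzT⟩, -⟩ := hSV hz
    have := bounds_of_mem_vchunks (r : ℤ) (-(r : ℤ)) e s (hmemSL T hT) hzT
    exact ⟨this.1, this.2.1⟩
  obtain ⟨v, hvH, hvV⟩ := exists_mem_of_cross (L := (r : ℤ) - e) (R := (r : ℤ) + e) (B := t - 2 * h) (T := t - h - 1)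
    (by omega) (by omega) PH' (by rw [hsH.1]; omega) (by rw [hsH.2]; omega)
    (fun z hz _ _ => hSHb z hz)
    PV' (by rw [hX0]; exact hlo) (by rw [hX1]; exact hhi) (fun z hz _ _ => hSVb z hz)
  -- (3) assemble
  set U : Set (Site 2) := (boxAll (E :: L) ∪ (adjApproach r e t W h).box ∪ (adjTarget N' t h).box) ∩ χ with hU
  have hAU : boxAll (E :: L) ∩ χ ⊆ U := fun z hz => ⟨Or.inl (Or.inl hz.1), hz.2⟩
  have hVU : SV ⊆ U := fun z hz => by
    obtain ⟨⟨T, hT, hzT⟩, hzχ⟩ := hSV hz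
    exact ⟨Or.inl (Or.inl ⟨T, hSL T (hmemSL T hT), hzT⟩), hzχ⟩
  have hHU : SH ⊆ U := fun z hz => ⟨Or.inl (Or.inr (hSH hz).1), (hSH hz).2⟩
  have Q1 : PathIn triGraph U (X Te) (X (vPiece r (-(r : ℤ)) e s j₀)) :=
    ((chain_paths' X Y E L hch hXY Te hTe).symm.trans (chain_paths' X Y E L hch hXY _ (hSL _ (hmemSL _ List.mem_cons_self)))).mono hAU
  have Q2 : PathIn triGraph U (X (vPiece r (-(r : ℤ)) e s j₀)) v := (TV v hvV).mono hVU
  have Q3 : PathIn triGraph U v xH := (TH v hvH).symm.mono hHU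
  have Q4 : PathIn triGraph U xH xV := PHV.mono fun z hz => by
    rcases hz with ⟨hz | hz, hzχ⟩
    · exact ⟨Or.inl (Or.inr hz), hzχ⟩
    · exact ⟨Or.inr hz, hzχ⟩
  have Q5 : PathIn triGraph U xV yV := PV.mono fun z hz => ⟨Or.inr hz.1, hz.2⟩
  refine ⟨yV, ?_, PV.right_mem.1, (((Q1.trans Q2).trans Q3).trans Q4).trans Q5⟩
  have := hsV.2; push_cast at this; omega

end Literature.Probability.Percolation
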